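import Summits.BirchSwinnertonDyer.BirchSwinnertonDyer.Theorems.ManinLocalTwoThreeTameUnitTwist
import Summits.BirchSwinnertonDyer.BirchSwinnertonDyer.Theorems.ManinLocalTwoThreeEvenSpanLemma

/-!
# The FOURIER DESCENT in one `q`-tower: unipotent tower generation (E-an-137) ⟹ a primitive even character of
# conductor `qⁿ` with UNIT normalised twisted value (MEMO-an §71.3 + §71.5 (a); cell bsd-f2-manin, analytic lens g29)

Summit `BirchSwinnertonDyer`, route `ManinLocalTwoThree`, cruxes C3 `ManinPrimeToThreeAtNine` (stmt-BirchSwinnertonDyer-22968,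
input `h66`) / C2 `ManinOddAtFour` (stmt-…-22967, input `h66₂`).  Companion of `…TowerReduction` (E-an-136: E-es-66 ⟸ hnf ∧
E-an-135) — here the deeper edge of HOME/an/g29/Sketch-an-g29.lean: the f-specific tower law **E-an-135 `TowerUnitTwist p`
follows from its f-free parent E-an-137 `UnipotentTowerGeneration p q N`** (the classes `{b/qⁿ, (b + t q^{n-1})/qⁿ}_f`,
`q ∤ b`, `n ≥ n₁`, generate `Λ₁(f)` up to a prime-to-`p` index).  This file proves the CORE (the Euler factor `e_S(χ)` of
the polar witness is attached in the sequel):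

* `modularSymbol_intCast_div_sub_zero_mem_periodLattice` — `{∞, k/m}_f − {∞, 0}_f ∈ Λ_f` whenever `m ∣ M` with `M` prime
  to `N` (the cusp is `Γ₀(N)`-equivalent to `0`; LEMMA A `exists_gamma0_modularSymbol_div` on the reduced fraction).
* `DirichletCharacter.isPrimitive_of_apply_ne_one_of_mem_ker` — a character mod `qⁿ` that is non-trivial on
  `ker((ℤ/qⁿ)ˣ → (ℤ/q^{n-1})ˣ)` is PRIMITIVE.
* `exists_primitive_even_unit_twist_of_towerGeneration` — **THE DESCENT**: `f` a rational newform on `Γ₀(N)` with plus index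
  prime to the prime `p` (`PlusIndexPrimeTo p f`), `q ∤ N` an odd prime, `q ≠ p`, `p ∤ (q-1)/2`; if the tower differences of
  level `≥ n₁` generate `Λ₁(f)` up to prime-to-`p` index (E-an-137 at `f`, `n₁`, BY VALUE), then for some `n ≥ n₁` there is a
  PRIMITIVE EVEN `χ` mod `qⁿ` with `Σ_a χ(a){∞, a/qⁿ}_f = r·Ω⁺_f` and `s·r/p` NOT an algebraic integer for every `p ∤ s`.

PROOF (as p3's E-es-87♭ file `…TameUnitTwist`, THEOREM B′ replaced by the tower law and the span lemma by its EVEN version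
on `(ℤ/qⁿ)ˣ/±1`, `…EvenSpanLemma`): (1) `re Λ_f = ℤ·Ω⁺/2`; (2) if every tower difference had plus part in `pℤ·Ω⁺` so
would the closure they generate, which contains `k·y` (`p ∤ k`) for the `Γ₁`-period `y` with `y + ȳ = k₀·Ω⁺`, `p ∤ k₀`,
supplied by `PlusIndexPrimeTo p f` at a period `x₀` with `x₀ + x̄₀ = Ω⁺` — contradiction; (3) at the bad level `n`:
`F(a) := ({∞,a/qⁿ} − {∞,0} + conj)/Ω⁺ ∈ ℤ` is even and `p ∤ F(ub) − F(b)` for the unit `u = (b + tq^{n-1})·b⁻¹ ≡ 1 (mod q^{n-1})`;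
(4) the even span lemma (`p ∤ φ(qⁿ)/2`) yields an even `χ` with `χ(u) ≠ 1` — hence primitive — and `s·F̂(χ)/(2p)` never
integral; (5) `2·S_χ = Ω⁺·F̂(χ)`, `r = F̂(χ)/2`.

HONEST FRAMING: an f-level theorem about period lattices (no curve, no Manin constant); E-an-137 is a LAW taken as a
hypothesis by value.  C2/C3, Manin's conjecture and BSD are NOT proved by this.  No definitions, no named facts, no sorry.
-/

set_option linter.dupNamespace false
set_option autoImplicit false

noncomputable section

open scoped Classical MatrixGroups ModularForm ComplexConjugate

open CongruenceSubgroup Complex Literature.NumberTheory.EllipticCurves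
  Literature.NumberTheory.EllipticCurves.ModularForms
  Summit.BirchSwinnertonDyer.Rank1Residual.ManinAdditive.Gamma1Lattice
  Summit.BirchSwinnertonDyer.Rank1Residual.ManinAdditive.KatoCurve

namespace Summit.BirchSwinnertonDyer.BirchSwinnertonDyer.Theorems.ManinLocalTwoThree

variable {N : ℕ} [NeZero N] (f : CuspForm (Gamma0 N) 2)

/-! ### §1 Cusps of denominator prime to `N`; the symbols `y_a = {∞, a/m} − {∞, 0}` at a composite modulus
(the `ℤ/m` bookkeeping of `…TameUnitTwist` / `…DegeneracyUnitTwistSignMove`, there stated for PRIME `m`, is redone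
privately for an arbitrary modulus `m` prime to `N`) -/

/-- **`{∞, k/m}_f − {∞, 0}_f ∈ Λ_f` whenever `m ∣ M` with `M` prime to `N`** (reduce the fraction; its denominator is
prime to `N`, so the cusp is `Γ₀(N)`-equivalent to `0`: LEMMA A `exists_gamma0_modularSymbol_div`). [folklore] -/
theorem modularSymbol_intCast_div_sub_zero_mem_periodLattice {M : ℕ} (hM : IsCoprime (N : ℤ) M) (k : ℤ) {m : ℤ}
    (hmM : m ∣ (M : ℤ)) : modularSymbol f ((k : ℚ) / m) - modularSymbol f 0 ∈ periodLattice f := by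
  set r : ℚ := (k : ℚ) / m with hr
  have hden0 : (r.den : ℤ) ≠ 0 := by exact_mod_cast r.den_ne_zero
  have hcop : IsCoprime r.num (r.den : ℤ) := Int.isCoprime_iff_gcd_eq_one.mpr r.reduced
  have hdvd : (r.den : ℤ) ∣ m := by
    have h := Rat.den_dvd k m
    rwa [← Rat.intCast_div_eq_divInt] at h
  have hNd : IsCoprime (N : ℤ) (r.den : ℤ) := by
    obtain ⟨c, hc⟩ := hdvd.trans hmM
    rw [hc] at hM
    exact hM.of_mul_right_left
  obtain ⟨δ, -, -, hδ⟩ := exists_gamma0_modularSymbol_div f hden0 hcop hNd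
  have e : ((r.num : ℤ) : ℚ) / ((r.den : ℤ) : ℚ) = r := by push_cast; exact Rat.num_div_den r
  rw [e] at hδ
  rw [hδ, add_sub_cancel_right]
  exact cuspSymbol_mem_periodLattice f δ

section Level

variable {m : ℕ} [NeZero m]

omit [NeZero N] [NeZero m] in
/-- `y_0 = 0` for `y_a := {∞, a/m}_f − {∞, 0}_f` (representative `a.val ∈ [0, m)`). -/
private theorem ySymbLevel_zero : modularSymbol f (((0 : ZMod m).val : ℚ) / m) - modularSymbol f 0 = 0 := by
  simp [ZMod.val_zero]

omit [NeZero m] in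
/-- `y_a ∈ Λ_f` for EVERY `a : ℤ/m` when `m` is prime to `N` (also for non-units `a`). -/
private theorem ySymbLevel_mem_periodLattice (hNm : IsCoprime (N : ℤ) m) (a : ZMod m) :
    modularSymbol f ((a.val : ℚ) / m) - modularSymbol f 0 ∈ periodLattice f := by
  have e : ((a.val : ℤ) : ℚ) / ((m : ℤ) : ℚ) = (a.val : ℚ) / m := by push_cast; rfl
  rw [← e]
  exact modularSymbol_intCast_div_sub_zero_mem_periodLattice f hNm _ dvd_rfl

/-- `y_{−a} = conj y_a` for `f` with real coefficients (`{∞, (m − a)/m} = {∞, −a/m} = conj {∞, a/m}`). -/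
private theorem ySymbLevel_neg (hreal : ∀ n, (cuspCoeff f n).im = 0) (a : ZMod m) :
    modularSymbol f (((-a).val : ℚ) / m) - modularSymbol f 0 =
      conj (modularSymbol f ((a.val : ℚ) / m) - modularSymbol f 0) := by
  have h0 : conj (modularSymbol f 0) = modularSymbol f 0 := by
    have := modularSymbol_neg_eq_conj_holds f hreal 0
    rw [neg_zero] at this
    exact this.symm
  by_cases ha : a = 0
  · rw [ha, neg_zero, ySymbLevel_zero, map_zero]
  · have hval : (-a).val = m - a.val := by rw [ZMod.neg_val, if_neg ha]
    have hlt : a.val ≤ m := (ZMod.val_lt a).le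
    have hmQ : (m : ℚ) ≠ 0 := by exact_mod_cast (NeZero.ne m)
    have e : (((-a).val : ℚ) / m) = -((a.val : ℚ) / m) + ((1 : ℤ) : ℚ) := by
      rw [hval, Nat.cast_sub hlt]
      field_simp
      push_cast
      ring
    rw [e, modularSymbol_add_intCast_holds f, modularSymbol_neg_eq_conj_holds f hreal, map_sub, h0]

/-- `{∞, b/m}_f = {∞, (b mod m)/m}_f` (translation invariance). -/
private theorem modularSymbol_intCast_div_eq_val (b : ℤ) :
    modularSymbol f ((b : ℚ) / ((m : ℤ) : ℚ)) = modularSymbol f ((((b : ZMod m)).val : ℚ) / m) := by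
  have hmQ : (m : ℚ) ≠ 0 := by exact_mod_cast (NeZero.ne m)
  have hv : (((b : ZMod m)).val : ℤ) = b % m := ZMod.val_intCast b
  have hb : (b : ℚ) / ((m : ℤ) : ℚ) = ((((b : ZMod m)).val : ℚ) / m) + ((b / m : ℤ) : ℚ) := by
    have e1 : (b : ℚ) = ((b % m : ℤ) : ℚ) + (m : ℚ) * ((b / m : ℤ) : ℚ) := by
      exact_mod_cast (Int.emod_add_mul_ediv b m).symm
    have e2 : ((((b : ZMod m)).val : ℚ)) = ((b % m : ℤ) : ℚ) := by exact_mod_cast hv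
    rw [e2, e1]
    push_cast
    field_simp
  rw [hb, modularSymbol_add_intCast_holds f]

/-- **Half-sum identity** at any modulus: for a non-trivial EVEN `χ` mod `m` and `f` with real coefficients,
`2 · Σ_a χ(a){∞, a/m}_f = Σ_a χ(a)·(y_a + ȳ_a)` (`Σ_a χ(a) = 0` removes `{∞, 0}`; reindex `a ↦ −a`). -/
private theorem two_mul_twistedSymbolSum_eq_sum (hreal : ∀ n, (cuspCoeff f n).im = 0) {χ : DirichletCharacter ℂ m}
    (hχ : χ ≠ 1) (hev : χ.Even) :
    2 * twistedSymbolSum f χ = ∑ a : ZMod m, χ a * ((modularSymbol f ((a.val : ℚ) / m) - modularSymbol f 0) +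
      conj (modularSymbol f ((a.val : ℚ) / m) - modularSymbol f 0)) := by
  have hS : twistedSymbolSum f χ = ∑ a : ZMod m, χ a * (modularSymbol f ((a.val : ℚ) / m) - modularSymbol f 0) := by
    have : ∑ a : ZMod m, χ a * (modularSymbol f ((a.val : ℚ) / m) - modularSymbol f 0) =
        ∑ a : ZMod m, χ a * modularSymbol f ((a.val : ℚ) / m) - (∑ a : ZMod m, χ a) * modularSymbol f 0 := by
      simp only [mul_sub, Finset.sum_sub_distrib, Finset.sum_mul]
    rw [this, χ.sum_eq_zero_of_ne_one hχ, zero_mul, sub_zero]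
    rfl
  have hS' : twistedSymbolSum f χ =
      ∑ a : ZMod m, χ a * conj (modularSymbol f ((a.val : ℚ) / m) - modularSymbol f 0) := by
    rw [hS]
    refine Fintype.sum_equiv (Equiv.neg (ZMod m)) _ _ fun a ↦ ?_
    rw [Equiv.neg_apply, hev.eval_neg, ySymbLevel_neg f hreal, Complex.conj_conj]
  rw [two_mul]
  nth_rewrite 1 [hS]
  rw [hS', ← Finset.sum_add_distrib]
  refine Finset.sum_congr rfl fun a _ ↦ ?_
  ring

end Level

/-! ### §2 Primitivity from non-triviality on the kernel of reduction -/

omit [NeZero N] in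
/-- A Dirichlet character mod `qⁿ` that is non-trivial at some unit of the kernel of `(ℤ/qⁿ)ˣ → (ℤ/q^{n-1})ˣ` is
PRIMITIVE (an imprimitive character factors through `q^{n-1}` and kills that kernel). [folklore] -/
theorem DirichletCharacter.isPrimitive_of_apply_ne_one_of_mem_ker {q n : ℕ} (hq : q.Prime)
    {χ : DirichletCharacter ℂ (q ^ n)} {u : (ZMod (q ^ n))ˣ}
    (hu : u ∈ (ZMod.unitsMap (pow_dvd_pow q (Nat.sub_le n 1))).ker) (hχu : χ (u : ZMod (q ^ n)) ≠ 1) :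
    χ.IsPrimitive := by
  haveI : NeZero (q ^ n) := ⟨pow_ne_zero _ hq.ne_zero⟩
  haveI : Fact q.Prime := ⟨hq⟩
  by_contra hprim
  obtain ⟨j, hjn, hj⟩ := (Nat.dvd_prime_pow hq).mp χ.conductor_dvd_level
  have hjlt : j < n := by
    rcases Nat.lt_or_ge j n with h | h
    · exact h
    · exact absurd (by rw [DirichletCharacter.isPrimitive_def, hj, le_antisymm hjn h]) hprim
  have hfac : χ.FactorsThrough (q ^ (n - 1)) :=
    (hj ▸ χ.factorsThrough_conductor).mono χ (pow_dvd_pow q (by omega)) (pow_dvd_pow q (Nat.sub_le n 1))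
  have hker := (DirichletCharacter.factorsThrough_iff_ker_unitsMap (pow_dvd_pow q (Nat.sub_le n 1))).mp hfac hu
  rw [MonoidHom.mem_ker, Units.ext_iff, MulChar.coe_toUnitHom, Units.val_one] at hker
  exact hχu hker

/-! ### §3 From the plus index and tower generation to ONE tower difference with plus part `≢ 0 (mod pΩ⁺)` -/

variable {f}

/-- If the plus index is prime to `p` and the tower differences of level `≥ n₁` generate `Λ₁(f)` up to prime-to-`p`
index, then some tower difference `z = {∞, (b + tq^{n-1})/qⁿ}_f − {∞, b/qⁿ}_f`, `n ≥ max n₁ 1`, `q ∤ b`, has plus part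
`z + z̄ = j·Ω⁺_f` with `p ∤ j` (closure induction). -/
theorem exists_towerDifference_plus_not_dvd (hf : IsNewform0 f) (hQ : coeffField f = ⊥) {p : ℕ} (hp : p.Prime)
    (hd : PlusIndexPrimeTo p f) {q : ℕ} (hq : q.Prime) (hqN : ¬ q ∣ N) {n₁ : ℕ} (hn₁ : 2 ≤ n₁)
    (hgen : ∀ y ∈ periodLatticeGamma1 f, ∃ k : ℕ, ¬ p ∣ k ∧ (k : ℂ) * y ∈ AddSubgroup.closure
      (⋃ (n : ℕ) (_ : n₁ ≤ n) (_ : 1 ≤ n), {z : ℂ | ∃ b t : ℤ, ¬ (q : ℤ) ∣ b ∧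
        z = modularSymbol f (((b + t * (q : ℤ) ^ (n - 1) : ℤ) : ℚ) / (q : ℚ) ^ n) -
            modularSymbol f ((b : ℚ) / (q : ℚ) ^ n)})) :
    ∃ n : ℕ, n₁ ≤ n ∧ 2 ≤ n ∧ ∃ b t : ℤ, ¬ (q : ℤ) ∣ b ∧ ∃ j : ℤ,
      (modularSymbol f (((b + t * (q : ℤ) ^ (n - 1) : ℤ) : ℚ) / (q : ℚ) ^ n) - modularSymbol f ((b : ℚ) / (q : ℚ) ^ n)) +
        conj (modularSymbol f (((b + t * (q : ℤ) ^ (n - 1) : ℤ) : ℚ) / (q : ℚ) ^ n) -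
          modularSymbol f ((b : ℚ) / (q : ℚ) ^ n)) = (j : ℂ) * (plusPeriod f : ℂ) ∧ ¬ (p : ℤ) ∣ j := by
  obtain ⟨hpos, -⟩ := plusPeriod_pos_and_realPeriods_eq isZLattice_periodLattice_holds hf hQ
  have hΩ : (plusPeriod f : ℂ) ≠ 0 := by exact_mod_cast hpos.ne'
  by_contra hcon
  push Not at hcon
  -- every tower difference lies in `Λ_f`
  have hmemΛ : ∀ (n : ℕ) (b t : ℤ),
      modularSymbol f (((b + t * (q : ℤ) ^ (n - 1) : ℤ) : ℚ) / (q : ℚ) ^ n) - modularSymbol f ((b : ℚ) / (q : ℚ) ^ n)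
        ∈ periodLattice f := by
    intro n b t
    have hNq : IsCoprime (N : ℤ) ((q ^ n : ℕ) : ℤ) := by
      rw [Nat.cast_pow]
      exact IsCoprime.pow_right (Nat.isCoprime_iff_coprime.mpr
        (Nat.coprime_comm.mp ((Nat.Prime.coprime_iff_not_dvd hq).mpr hqN)))
    have h1 := modularSymbol_intCast_div_sub_zero_mem_periodLattice f hNq (b + t * (q : ℤ) ^ (n - 1))
      (m := (q : ℤ) ^ n) (by push_cast; exact dvd_rfl)
    have h2 := modularSymbol_intCast_div_sub_zero_mem_periodLattice f hNq b
      (m := (q : ℤ) ^ n) (by push_cast; exact dvd_rfl)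
    have e : modularSymbol f (((b + t * (q : ℤ) ^ (n - 1) : ℤ) : ℚ) / (q : ℚ) ^ n) -
        modularSymbol f ((b : ℚ) / (q : ℚ) ^ n) =
        (modularSymbol f (((b + t * (q : ℤ) ^ (n - 1) : ℤ) : ℚ) / (((q : ℤ) ^ n : ℤ) : ℚ)) - modularSymbol f 0) -
          (modularSymbol f ((b : ℚ) / (((q : ℤ) ^ n : ℤ) : ℚ)) - modularSymbol f 0) := by
      push_cast; ring
    rw [e]
    exact sub_mem h1 h2
  -- every element of the closure has plus part in `pℤ·Ω⁺`
  have hall : ∀ y ∈ AddSubgroup.closure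
      (⋃ (n : ℕ) (_ : n₁ ≤ n) (_ : 1 ≤ n), {z : ℂ | ∃ b t : ℤ, ¬ (q : ℤ) ∣ b ∧
        z = modularSymbol f (((b + t * (q : ℤ) ^ (n - 1) : ℤ) : ℚ) / (q : ℚ) ^ n) -
            modularSymbol f ((b : ℚ) / (q : ℚ) ^ n)}),
      ∃ j : ℤ, y + conj y = (j : ℂ) * (plusPeriod f : ℂ) ∧ (p : ℤ) ∣ j := by
    intro y hy
    induction hy using AddSubgroup.closure_induction with
    | mem z hz =>
      simp only [Set.mem_iUnion, Set.mem_setOf_eq] at hz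
      obtain ⟨n, hn, hn1, b, t, hb, rfl⟩ := hz
      obtain ⟨j, hj⟩ := exists_int_add_conj_eq_mul_plusPeriod hf hQ (hmemΛ n b t)
      exact ⟨j, hj, hcon n hn (le_trans hn₁ hn) b t hb j hj⟩
    | zero => exact ⟨0, by simp, dvd_zero _⟩
    | add x y _ _ hx hy =>
      obtain ⟨j₁, hj₁, h₁⟩ := hx
      obtain ⟨j₂, hj₂, h₂⟩ := hy
      refine ⟨j₁ + j₂, ?_, dvd_add h₁ h₂⟩
      rw [map_add, Int.cast_add, add_mul, ← hj₁, ← hj₂]; ring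
    | neg x _ hx =>
      obtain ⟨j, hj, h⟩ := hx
      refine ⟨-j, ?_, (dvd_neg).mpr h⟩
      rw [map_neg, Int.cast_neg, neg_mul, ← hj]; ring
  obtain ⟨x₀, hx₀, hx₀Ω⟩ := exists_mem_periodLattice_add_conj_eq_plusPeriod hf hQ
  obtain ⟨y, hy, k, hkp, hk⟩ := hd x₀ hx₀
  obtain ⟨k', hk'p, hk'y⟩ := hgen y hy
  obtain ⟨j, hj, hjp⟩ := hall _ hk'y
  rw [hx₀Ω] at hk
  have hkk : (((k' * k : ℕ) : ℤ) : ℂ) * (plusPeriod f : ℂ) = (j : ℂ) * (plusPeriod f : ℂ) := by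
    rw [← hj, map_mul, Complex.conj_natCast, ← mul_add, ← hk]
    push_cast
    ring
  have hkj : ((k' * k : ℕ) : ℤ) = j := by
    have h1 := mul_right_cancel₀ hΩ hkk
    exact_mod_cast h1
  have : p ∣ k' * k := Int.natCast_dvd_natCast.mp (hkj ▸ hjp)
  rcases (Nat.Prime.dvd_mul hp).mp this with h | h
  · exact hk'p h
  · exact hkp h

/-! ### §4 THE DESCENT: a primitive even character of conductor `qⁿ` with unit normalised twisted value -/

/-- **Fourier descent in the `q`-tower (MEMO-an §71.3, §71.5 (a)): E-an-137 at `(f, n₁)` ⟹ the unit twist of E-an-135 at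
some level `n ≥ n₁`** — for a rational newform `f ∈ S₂(Γ₀(N))` with plus index prime to the prime `p`, an odd prime
`q ∤ N`, `q ≠ p`, `p ∤ (q-1)/2`: some PRIMITIVE EVEN Dirichlet character `χ` of conductor `qⁿ`, `n ≥ n₁`, has
`Σ_a χ(a){∞, a/qⁿ}_f = r·Ω⁺_f` with `s·r/p` NOT an algebraic integer for every `p ∤ s`. -/
theorem exists_primitive_even_unit_twist_of_towerGeneration (hf : IsNewform0 f) (hQ : coeffField f = ⊥)
    {p : ℕ} (hp : p.Prime) (hd : PlusIndexPrimeTo p f) {q : ℕ} [Fact q.Prime] (hq2 : q ≠ 2) (hqp : q ≠ p)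
    (hqN : ¬ q ∣ N) (hpq : ¬ p ∣ (q - 1) / 2) {n₁ : ℕ} (hn₁ : 2 ≤ n₁)
    (hgen : ∀ y ∈ periodLatticeGamma1 f, ∃ k : ℕ, ¬ p ∣ k ∧ (k : ℂ) * y ∈ AddSubgroup.closure
      (⋃ (n : ℕ) (_ : n₁ ≤ n) (_ : 1 ≤ n), {z : ℂ | ∃ b t : ℤ, ¬ (q : ℤ) ∣ b ∧
        z = modularSymbol f (((b + t * (q : ℤ) ^ (n - 1) : ℤ) : ℚ) / (q : ℚ) ^ n) -
            modularSymbol f ((b : ℚ) / (q : ℚ) ^ n)})) :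
    ∃ n : ℕ, n₁ ≤ n ∧ ∃ (χ : DirichletCharacter ℂ (q ^ n)) (r : ℂ), χ.IsPrimitive ∧ χ.Even ∧
      twistedSymbolSum f χ = r * (plusPeriod f : ℂ) ∧ ∀ s : ℕ, ¬ p ∣ s → ¬ IsIntegral ℤ ((s : ℂ) * r / p) := by
  have hq : q.Prime := Fact.out
  have hq3 : 3 ≤ q := by
    rcases hq.eq_two_or_odd' with h | h
    · exact absurd h hq2
    · have := hq.two_le; rcases h with ⟨k, hk⟩; omega
  obtain ⟨hpos, -⟩ := plusPeriod_pos_and_realPeriods_eq isZLattice_periodLattice_holds hf hQ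
  have hΩ : (plusPeriod f : ℂ) ≠ 0 := by exact_mod_cast hpos.ne'
  have hreal : ∀ n, (cuspCoeff f n).im = 0 := cuspCoeff_im_eq_zero_of_coeffField_eq_bot hQ
  -- §3: one bad tower difference at some level `n ≥ max n₁ 1`
  obtain ⟨n, hn, hn2, b, t, hb, j, hj, hjp⟩ := exists_towerDifference_plus_not_dvd hf hQ hp hd hq hqN hn₁ hgen
  haveI : NeZero (q ^ n) := ⟨pow_ne_zero _ hq.ne_zero⟩
  have hqZ : IsCoprime (q : ℤ) b := by
    rw [Int.isCoprime_iff_gcd_eq_one]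
    exact (Nat.Prime.coprime_iff_not_dvd hq).mpr fun h ↦ hb (Int.natCast_dvd.mpr h)
  have hNm : IsCoprime (N : ℤ) ((q ^ n : ℕ) : ℤ) := by
    rw [Nat.cast_pow]
    exact IsCoprime.pow_right (Nat.isCoprime_iff_coprime.mpr
      (Nat.coprime_comm.mp ((Nat.Prime.coprime_iff_not_dvd hq).mpr hqN)))
  -- the integer-valued even function `F` on `ℤ/qⁿ`
  have hF : ∀ a : ZMod (q ^ n), ∃ k : ℤ, (modularSymbol f ((a.val : ℚ) / (q ^ n : ℕ)) - modularSymbol f 0) +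
      conj (modularSymbol f ((a.val : ℚ) / (q ^ n : ℕ)) - modularSymbol f 0) = (k : ℂ) * (plusPeriod f : ℂ) :=
    fun a ↦ exists_int_add_conj_eq_mul_plusPeriod hf hQ (ySymbLevel_mem_periodLattice f hNm a)
  choose F hF using hF
  have hFeven : ∀ a : ZMod (q ^ n), F (-a) = F a := by
    intro a
    have h1 := hF (-a)
    rw [ySymbLevel_neg f hreal, Complex.conj_conj, add_comm, hF a] at h1
    exact_mod_cast (mul_right_cancel₀ hΩ h1).symm
  -- `j = F(b') − F(b)` for the residues `b' = b + t q^{n-1}`, `b`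
  have hmq : (((q ^ n : ℕ) : ℤ) : ℚ) = (q : ℚ) ^ n := by push_cast; ring
  have hzF : (j : ℂ) * (plusPeriod f : ℂ) =
      ((F ((b + t * (q : ℤ) ^ (n - 1) : ℤ) : ZMod (q ^ n)) - F ((b : ℤ) : ZMod (q ^ n)) : ℤ) : ℂ) *
        (plusPeriod f : ℂ) := by
    rw [← hj, ← hmq, modularSymbol_intCast_div_eq_val f (b + t * (q : ℤ) ^ (n - 1)),
      modularSymbol_intCast_div_eq_val f b]
    have e : modularSymbol f ((((b + t * (q : ℤ) ^ (n - 1) : ℤ) : ZMod (q ^ n)).val : ℚ) / (q ^ n : ℕ)) -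
        modularSymbol f ((((b : ℤ) : ZMod (q ^ n)).val : ℚ) / (q ^ n : ℕ)) =
        (modularSymbol f ((((b + t * (q : ℤ) ^ (n - 1) : ℤ) : ZMod (q ^ n)).val : ℚ) / (q ^ n : ℕ)) -
            modularSymbol f 0) -
          (modularSymbol f ((((b : ℤ) : ZMod (q ^ n)).val : ℚ) / (q ^ n : ℕ)) - modularSymbol f 0) := by ring
    rw [e, map_sub, Int.cast_sub, sub_mul, ← hF, ← hF]
    ring
  have hjF : j = F ((b + t * (q : ℤ) ^ (n - 1) : ℤ) : ZMod (q ^ n)) - F ((b : ℤ) : ZMod (q ^ n)) := by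
    have := mul_right_cancel₀ hΩ hzF
    exact_mod_cast this
  -- the residues are units; `u := b' · b⁻¹` lies in the kernel of reduction modulo `q^{n-1}`
  have hbcop : IsCoprime b ((q ^ n : ℕ) : ℤ) := by
    rw [Nat.cast_pow]; exact hqZ.symm.pow_right
  obtain ⟨k, hk⟩ : ∃ k, n - 1 = k + 1 := ⟨n - 2, by omega⟩
  have hb' : b + t * (q : ℤ) ^ (n - 1) = b + (q : ℤ) * (t * (q : ℤ) ^ k) := by rw [hk, pow_succ]; ring
  have hb'cop : IsCoprime (b + t * (q : ℤ) ^ (n - 1)) ((q ^ n : ℕ) : ℤ) := by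
    rw [Nat.cast_pow, hb']
    exact (hqZ.add_mul_left_right (t * (q : ℤ) ^ k)).symm.pow_right
  obtain ⟨ua, hua⟩ : IsUnit ((b : ℤ) : ZMod (q ^ n)) := (ZMod.coe_int_isUnit_iff_isCoprime b (q ^ n)).mpr hbcop.symm
  obtain ⟨ua', hua'⟩ : IsUnit (((b + t * (q : ℤ) ^ (n - 1) : ℤ)) : ZMod (q ^ n)) :=
    (ZMod.coe_int_isUnit_iff_isCoprime _ (q ^ n)).mpr hb'cop.symm
  have hu_mul : ((ua' * ua⁻¹ : (ZMod (q ^ n))ˣ) : ZMod (q ^ n)) * (ua : ZMod (q ^ n)) =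
      ((b + t * (q : ℤ) ^ (n - 1) : ℤ) : ZMod (q ^ n)) := by
    rw [← Units.val_mul, inv_mul_cancel_right, hua']
  have hu_ker : (ua' * ua⁻¹ : (ZMod (q ^ n))ˣ) ∈ (ZMod.unitsMap (pow_dvd_pow q (Nat.sub_le n 1))).ker := by
    rw [MonoidHom.mem_ker, map_mul, map_inv, mul_inv_eq_one]
    apply Units.ext
    rw [ZMod.unitsMap_val, ZMod.unitsMap_val, hua, hua', ZMod.cast_intCast (pow_dvd_pow q (Nat.sub_le n 1)),
      ZMod.cast_intCast (pow_dvd_pow q (Nat.sub_le n 1)), hk]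
    push_cast
    rw [← Nat.cast_pow, ZMod.natCast_self]
    ring
  -- `p ∤ φ(qⁿ)/2 = q^{n-1} (q-1)/2`, `qⁿ > 2`
  have hqodd : q % 2 = 1 := hq.eq_two_or_odd.resolve_left hq2
  have hφ : ¬ p ∣ (q ^ n).totient / 2 := by
    rw [Nat.totient_prime_pow hq (by omega), Nat.mul_div_assoc _ (show 2 ∣ q - 1 by omega)]
    intro h
    rcases (Nat.Prime.dvd_mul hp).mp h with h1 | h1
    · exact hqp ((Nat.prime_dvd_prime_iff_eq hp hq).mp (hp.dvd_of_dvd_pow h1)).symm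
    · exact hpq h1
  have h2m : 2 < q ^ n := lt_of_lt_of_le (by omega) (Nat.le_self_pow (by omega) q)
  -- §4: the even span lemma, contrapositively
  have hex : ∃ χ : DirichletCharacter ℂ (q ^ n), χ.Even ∧ χ ((ua' * ua⁻¹ : (ZMod (q ^ n))ˣ) : ZMod (q ^ n)) ≠ 1 ∧
      ∀ s : ℕ, ¬ p ∣ s → ¬ IsIntegral ℤ ((s : ℂ) * (∑ a : ZMod (q ^ n), χ a * (F a : ℂ)) / (2 * p)) := by
    by_contra hcon
    push Not at hcon
    have h := Int.dvd_sub_of_forall_even_isIntegral_charSum_div_of_apply_ne_one h2m hp hφ F hFeven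
      (Units.isUnit (ua' * ua⁻¹)) (fun χ he hne ↦ hcon χ he hne) (Units.isUnit ua)
    rw [hu_mul, hua, ← hjF] at h
    exact hjp h
  obtain ⟨χ, hev, hχu, hχ⟩ := hex
  have hprim : χ.IsPrimitive := DirichletCharacter.isPrimitive_of_apply_ne_one_of_mem_ker hq hu_ker hχu
  have hχ1 : χ ≠ 1 := fun h ↦ hχu (by rw [h, MulChar.one_apply_coe])
  -- §5: half-sum identity, `r = F̂(χ)/2`
  refine ⟨n, hn, χ, (∑ a : ZMod (q ^ n), χ a * (F a : ℂ)) / 2, hprim, hev, ?_, ?_⟩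
  · have h2 := two_mul_twistedSymbolSum_eq_sum f hreal hχ1 hev
    simp_rw [hF, ← mul_assoc, ← Finset.sum_mul] at h2
    have : twistedSymbolSum f χ = (∑ a : ZMod (q ^ n), χ a * (F a : ℂ)) * (plusPeriod f : ℂ) / 2 := by
      rw [← h2]; ring
    rw [this]; ring
  · intro s hs hI
    refine hχ s hs ?_
    have e : ((s : ℂ) * (∑ a : ZMod (q ^ n), χ a * (F a : ℂ)) / (2 * p)) =
        (s : ℂ) * ((∑ a : ZMod (q ^ n), χ a * (F a : ℂ)) / 2) / p := by ring
    rwa [e]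

end Summit.BirchSwinnertonDyer.BirchSwinnertonDyer.Theorems.ManinLocalTwoThree

end
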